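import Summits.QuantumFields.BalabanUV.T4Continuum.Support.B13StepOfRecordSecantStructural
import Summits.QuantumFields.BalabanUV.T4Continuum.Support.B13StepOfRecordSecantTermwiseWitness

/-!
# NE5 ∕ U3 — NON-VACUITY WITNESS for the secant END of record IN STRUCTURAL CURRENCIES (`B13StepOfRecordSecantStructural`): leaf-10's
# ZERO slot package satisfies the owner's structural shapes `ActOpFibre`, `ActOpIntegral` and `InsOpComposition` together with every
# other displayed binder — the structural ENDs FIRE on Bałaban's carriers of record

Cell `pub-balaban`, unit `b2b-balaban-t4-ne5-formalise-leaf-01` (NE5 formalisation swarm, LEAF PROVER 01, gen 5; journal INTENT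
`B13StepOfRecordSecantStructural` l.10104 ∕ witness l.10315; the pattern of this lineage's `B13StepOfRecordSecantTermwiseWitness` p213787 and of
leaf-10's `B13StepEndWitness` p211760, whose zero package `zeroSlots`, zero activity data `zeroActData` and binder lemmas are consumed BY
NAME).  Summits-side bookkeeping (a CONSISTENCY witness: nothing of [Balaban1988RG2Cluster] is modelled or asserted; NOT NE5 progress).
HONEST FRAMING: rung (B)+1 of the FINITE-VOLUME T⁴ continuum programme — NOT infinite volume, NOT a mass gap, NOT the Clay problem, NOT a
proof of NE5 (spine 0∕9).  HONEST DEPENDENCY (cell line, verbatim): continuum YM on T⁴ ⇐ BetaPertH ∧ nine spine estimates (0/9 proved);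
BetaPertH ⇐ (D1) ∧ (D4) ∧ CAP+tail; G-an2-4 gates asym, D1 and NE2/3/4.

WHAT THIS FILE DOES.  §1 the owner's three STRUCTURAL shapes hold for the zero package with zero majorants: `actOpFibre_zero` (the zero
factor is complex differentiable along every operator line and bounded by `0`), `actOpIntegral_zero` (it IS the integral of the zero
integrand against the Dirac measure on `Unit`, operator domain `univ`, majorants `0`), `insOpComposition_zero` (the zero insertion is the
zero table functional composed with the identity configuration map, domains `univ`, bound `0·rHist`), `opIA_mem_zero`.  §2
**`end_fires_zeroSlots_secant_structural : 0 ≤ κ → NE5 (outA (zeroSlots R) 0 0) (outB (zeroSlots R) 0 0) W κ 1 0`** FROM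
`ne5_of_record_secant_structural` BY NAME (the END's constant EVALUATES TO `0` at the zero data — stated with the explicit constant, so the
statement is not a restatement of the lineage's `end_fires_zeroSlots_secant_termwise`), and **`end_fires_zeroSlots_secant_integral`** (window
`Set.univ`) FROM `ne5_of_record_secant_integral` BY NAME, every
other binder supplied by leaf-10's ∕ this lineage's zero lemmas and the explicit numbers `(EA₀, E₀, E₁, cA, cB, c₁, r₀, Gi, δI, ρ₁, k₁, θ,
θ′, ρ₀, k₀, B, N̄, ε, εop) = (0,0,1,0,0,0,1,0,0,0,0,½,1,½,1,0,0,0,0)`, `ω = ½`, `Rt = 64·log 162 + 64`, `ROp ≡ RHist ≡ 1` (the operator reach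
is now `ρ₀ = ½ < 1`, as the fibre route requires).  No hidden sign ∕ shape clash.  0 sorry; axioms ⊆ {propext,
Classical.choice, Quot.sound}.
-/

noncomputable section

open MeasureTheory Metric Set
open scoped BigOperators

namespace Summit.QuantumFields.BalabanUV.T4Continuum.B13StepOfRecordSecantStructuralWitness

open Literature.MathematicalPhysics.QuantumFieldTheory.Balaban1983to89
open Literature.MathematicalPhysics.QuantumFieldTheory.Balaban1983to89.T4OutputRate (NE5)
open Literature.MathematicalPhysics.QuantumFieldTheory.Balaban1983to89.T4InputCauchyRateSpecies (ballClass)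
open Summit.QuantumFields.BalabanUV.T4Continuum.B13Carriers (TwoRuns)
open Summit.QuantumFields.BalabanUV.T4Continuum.B13OpDatum (OpDatum)
open Summit.QuantumFields.BalabanUV.T4Continuum.B13StepTermLabels (InnerLabel)
open Summit.QuantumFields.BalabanUV.T4Continuum.B13StepTermSocket (labelsIndexing touchInc)
open Summit.QuantumFields.BalabanUV.T4Continuum.B13InnerData (Bnd b13InnerData)
open Summit.QuantumFields.BalabanUV.T4Continuum.B13Base (selfCtr)
open Summit.QuantumFields.BalabanUV.T4Continuum.B13Represents (Assembly)
open Summit.QuantumFields.BalabanUV.T4Continuum.B13DomainGeometryTR (domainGeometry)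
open Summit.QuantumFields.BalabanUV.T4Continuum.B13StepOfRecord (Slots assembly step outA outB)
open Summit.QuantumFields.BalabanUV.T4Continuum.B13StepEndWitness
open Summit.QuantumFields.BalabanUV.T4Continuum.B13StepOfRecordSecantTermwiseWitness (zeroActData actExpLinearOn_zero
  actExpNormBound_zero actAbsBound_zero shape238_zero)
open Summit.QuantumFields.BalabanUV.T4Continuum.OutputRateActOpFibre (ActOpFibre ActOpIntegral)
open Summit.QuantumFields.BalabanUV.T4Continuum.OutputRateInsertionStructural (InsOpComposition)
open Summit.QuantumFields.BalabanUV.T4Continuum.B13StepOfRecordSecantStructural (ne5_of_record_secant_structural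
  ne5_of_record_secant_integral)

variable {𝔾 : Type} [GaugeGroup 𝔾] (R : TwoRuns 𝔾) (E₀ cB : ℝ) (W : Set (ℕ → ℝ))

/-! ## §1 The structural shapes hold for the zero package -/

/-- [folklore] The owner's FIBRE shape for the zero terms with `Aop ≡ 0`: the zero factor is complex differentiable along every operator
line and bounded by `0` on the closed unit disc. -/
theorem actOpFibre_zero :
    ActOpFibre (labelsIndexing (domainGeometry R) (b13InnerData R)) (zeroSlots R).act (step (zeroSlots R) E₀ cB) W
      fun _ _ _ _ _ => 0 := by
  intro k g _ U p _ X _ i _ m u _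
  refine ⟨?_, fun ζ _ => ?_⟩
  · show DifferentiableOn ℂ (fun _ : ℂ => (0 : ℂ)) (closedBall 0 1)
    exact differentiableOn_const 0
  · show ‖(0 : ℂ)‖ ≤ 0
    rw [norm_zero]

/-- [folklore] The owner's INTEGRAL shape for the zero terms: at every base point the zero factor IS `∫ 0 dδ_()` over `Unit`, holomorphic
in the operator datum on `univ`, dominated locally and on the closed operator ball by the zero majorant of mass `0 ≤ Aop ≡ 0`. -/
theorem actOpIntegral_zero :
    ActOpIntegral (labelsIndexing (domainGeometry R) (b13InnerData R)) (zeroSlots R).act (step (zeroSlots R) E₀ cB) W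
      (fun _ _ _ _ _ => 0) (α := fun _ _ => Unit) (fun _ _ _ _ => Measure.dirac ()) (fun _ _ _ _ _ _ => (0 : ℂ))
      fun _ _ _ _ _ _ => Set.univ := by
  intro k g _ U p _ X _ i _ m
  refine ⟨Set.subset_univ _, fun _ _ => aestronglyMeasurable_const, Filter.Eventually.of_forall fun _ => differentiableOn_const 0,
    fun o₀ _ => ⟨1, one_pos, Set.subset_univ _, fun _ => 0, integrable_zero _ _ _,
      Filter.Eventually.of_forall fun _ _ _ => by rw [norm_zero]⟩,
    ⟨fun _ => 0, integrable_zero _ _ _, Filter.Eventually.of_forall fun _ _ _ => by rw [norm_zero], by simp⟩, fun _ _ => ?_⟩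
  show (0 : ℂ) = ∫ _ : Unit, (0 : ℂ) ∂(Measure.dirac ())
  rw [integral_zero]

/-- [folklore] The owner's COMPOSITION shape for the zero insertion datum (margin `rI = 1`): configuration space `ℂ`, configuration map the
identity, table functional `0`, operator and configuration domains `univ`, bound `0·rHist`. -/
theorem insOpComposition_zero (κ : ℝ) :
    InsOpComposition ((zeroSlots R).D.toInsOpModel (step (zeroSlots R) E₀ cB) (fun _ => 1) (fun _ => one_pos)) W κ E₀ 0
      (Cfg := fun _ => ℂ) (fun _ o => o) (fun _ _ _ => (0 : ℂ)) (fun _ _ _ => Set.univ) fun _ _ _ => Set.univ := by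
  intro k g _ U
  refine ⟨Set.subset_univ _, differentiableOn_id, Set.mapsTo_univ _ _, fun t _ => ⟨differentiableOn_const 0, fun _ _ => ?_, fun o _ => ?_⟩⟩
  · show ‖(0 : ℂ)‖ ≤ 0 * (1 : ℝ)
    rw [norm_zero, zero_mul]
  · show (zeroInsDatum R.carriers).ins k o t = 0
    exact ins_zero R k o t

/-- [folklore] Run A's insertion-operator datum of the zero package lies in the operator domain `univ`. -/
theorem opIA_mem_zero :
    ∀ k, ∀ g ∈ W, ∀ (U : R.carriers.BgB),
      ((zeroSlots R).D.toInsOpModel (step (zeroSlots R) E₀ cB) (fun _ => 1) (fun _ => one_pos)).opIA g U k ∈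
        (fun (_ : ℕ) (_ : ℕ → ℝ) (_ : R.carriers.BgB) => (Set.univ : Set ℂ)) k g U :=
  fun _ _ _ _ => Set.mem_univ _

/-! ## §2 The structural ENDs fire for the zero package -/

/-- [folklore] **NON-VACUITY OF THE STRUCTURAL SECANT END ON BAŁABAN's CARRIERS OF RECORD.**  For EVERY pair of runs `R`, window `W` and
rate `κ ≥ 0` the zero slot package satisfies EVERY hypothesis of `B13StepOfRecordSecantStructural.ne5_of_record_secant_structural` — reading,
slice budgets, levels, W1 entry data, the insertion COMPOSITION shape + membership + NE2-type rate (§1, leaf-10's lemmas), the FIBRE shape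
(§1), the STRUCTURE with `zeroActData`, exponent bounds ∕ majorants at `0`, both (2.38) shapes at `ε = 0` with rate room
`Rt = 64·log 162 + 64`, radii `ROp ≡ RHist ≡ 1`, numbers `(E₁, r₀, θ, θ′, ρ₀, ω) = (1, 1, ½, 1, ½, ½)`, all other letters `0` — so
the END FIRES, and its constant evaluates to `0`: `NE5 (outA (zeroSlots R) 0 0) (outB (zeroSlots R) 0 0) W κ 1 0`.  The binder list is
therefore JOINTLY SATISFIABLE. -/
theorem end_fires_zeroSlots_secant_structural {κ : ℝ} (hκ : 0 ≤ κ) :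
    NE5 (outA (zeroSlots R) 0 0) (outB (zeroSlots R) 0 0) W κ 1 0 := by
  have h := ne5_of_record_secant_structural (zeroSlots R) 0 0 (W := W) (ROp := fun _ => 1) (RHist := fun _ => 1)
    (N := fun _ _ _ _ _ => 0) (A := fun _ _ _ _ _ => 0) (A' := fun _ _ _ _ _ => 0)
    (Aop := fun _ _ _ _ _ => 0) (Aop' := fun _ _ _ _ _ => 0) (Dt := zeroActData R) (Nbar := 0) (ε := 0) (εop := 0)
    (Rt := 64 * Real.log 162 + 64) (EA₀ := 0) (E₁ := 1) (cA := 0) (c₁ := 0) (r₀ := 1) (Gi := 0) (δI := 0) (ρ₁ := 0) (θ := 1 / 2)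
    (θ' := 1) (ρ₀ := 1 / 2) (B := 0) (k₀ := 0) (k₁ := 0) (fun _ => 1) (fun _ => one_pos)
    (Cfg := fun _ => ℂ) (cfg := fun _ o => o) (Φ := fun _ _ _ => (0 : ℂ)) (𝒪 := fun _ _ _ => Set.univ) (Dc := fun _ _ _ => Set.univ)
    (transportReads_zero R W) (sliceBudgetB_zero R W κ) (sliceBudget_zero R 0 0 W κ) (decayBound_outA_zero R 0 0 W κ)
    (decayBound_outB_zero R 0 0 W κ) (rawBounded_rawAt_zero R W) (rawBounded_rawB_zero R W)
    (weightedEntrywiseRate_zero R W fun k => (1 / 2 : ℝ) ^ k) (floor_zero R) (insOpComposition_zero R 0 0 W κ)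
    (opIA_mem_zero R 0 0 W) (insOpRate_zero R 0 0 W (1 / 2)) le_rfl le_rfl zero_lt_one (by norm_num)
    (actOpFibre_zero R 0 0 W) (fun _ _ _ _ _ => le_rfl) (fun _ _ _ _ _ => le_rfl) (fun _ _ _ _ _ => by simp) le_rfl
    (shape238_zero R W _) (by norm_num)
    (actExpLinearOn_zero R _ W) (actExpNormBound_zero R _ W _) (fun _ _ _ _ _ => le_rfl) (fun _ _ _ _ _ => le_rfl) le_rfl
    (actAbsBound_zero R _ W) (fun _ _ _ _ _ => le_rfl) (fun _ _ _ _ _ => le_rfl) hκ (fun _ _ _ _ _ => by simp) le_rfl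
    (shape238_zero R W _) le_rfl (by norm_num)
    (fun _ => by show (0 : ℝ) / 1 * 1 ≤ 1; norm_num)
    (fun k => by simp [Assembly.bHist])
    (fun _ => by rw [omega_zero]; show (0 * 0 / (1 - 0) + 2 * 0 / (1 / 2 : ℝ) ^ 0) * 1 + 0 * (1 * (0 / (1 - 1 / 2))) ≤ 1; norm_num)
    le_rfl le_rfl one_pos le_rfl le_rfl le_rfl one_pos (by norm_num) (by norm_num) le_rfl (by rw [omega_zero]; norm_num)
    (by rw [omega_zero]; norm_num) (by norm_num) (by norm_num) (by norm_num) le_rfl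
    (fun k hk => absurd hk (Nat.not_lt_zero k))
    (by rw [omega_zero]; norm_num)
  simp only [zero_mul, mul_zero, zero_div, add_zero] at h
  exact h

/-- [folklore] **… AND OF THE INTEGRAL END** (`ne5_of_record_secant_integral`, the operator side one level down): the same data with
`actOpIntegral_zero` in place of `actOpFibre_zero`, on the full window `Set.univ`: `NE5 (outA (zeroSlots R) 0 0) (outB (zeroSlots R) 0 0) univ κ 1 0`. -/
theorem end_fires_zeroSlots_secant_integral {κ : ℝ} (hκ : 0 ≤ κ) :
    NE5 (outA (zeroSlots R) 0 0) (outB (zeroSlots R) 0 0) Set.univ κ 1 0 := by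
  have h := ne5_of_record_secant_integral (zeroSlots R) 0 0 (W := Set.univ) (ROp := fun _ => 1) (RHist := fun _ => 1)
    (N := fun _ _ _ _ _ => 0) (A := fun _ _ _ _ _ => 0) (A' := fun _ _ _ _ _ => 0)
    (Aop := fun _ _ _ _ _ => 0) (Aop' := fun _ _ _ _ _ => 0) (Dt := zeroActData R) (Nbar := 0) (ε := 0) (εop := 0)
    (Rt := 64 * Real.log 162 + 64) (EA₀ := 0) (E₁ := 1) (cA := 0) (c₁ := 0) (r₀ := 1) (Gi := 0) (δI := 0) (ρ₁ := 0) (θ := 1 / 2)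
    (θ' := 1) (ρ₀ := 1 / 2) (B := 0) (k₀ := 0) (k₁ := 0) (fun _ => 1) (fun _ => one_pos)
    (Cfg := fun _ => ℂ) (cfg := fun _ o => o) (Φ := fun _ _ _ => (0 : ℂ)) (𝒪 := fun _ _ _ => Set.univ) (Dc := fun _ _ _ => Set.univ)
    (transportReads_zero R Set.univ) (sliceBudgetB_zero R Set.univ κ) (sliceBudget_zero R 0 0 Set.univ κ) (decayBound_outA_zero R 0 0 Set.univ κ)
    (decayBound_outB_zero R 0 0 Set.univ κ) (rawBounded_rawAt_zero R Set.univ) (rawBounded_rawB_zero R Set.univ)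
    (weightedEntrywiseRate_zero R Set.univ fun k => (1 / 2 : ℝ) ^ k) (floor_zero R) (insOpComposition_zero R 0 0 Set.univ κ)
    (opIA_mem_zero R 0 0 Set.univ) (insOpRate_zero R 0 0 Set.univ (1 / 2)) le_rfl le_rfl zero_lt_one (by norm_num)
    (α := fun _ _ => Unit) (μ := fun _ _ _ _ => Measure.dirac ()) (f := fun _ _ _ _ _ _ => (0 : ℂ)) (𝒪op := fun _ _ _ _ _ _ => Set.univ)
    (actOpIntegral_zero R 0 0 Set.univ) (fun _ _ _ _ _ => le_rfl) (fun _ _ _ _ _ => le_rfl) (fun _ _ _ _ _ => by simp) le_rfl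
    (shape238_zero R Set.univ _) (by norm_num)
    (actExpLinearOn_zero R _ Set.univ) (actExpNormBound_zero R _ Set.univ _) (fun _ _ _ _ _ => le_rfl) (fun _ _ _ _ _ => le_rfl) le_rfl
    (actAbsBound_zero R _ Set.univ) (fun _ _ _ _ _ => le_rfl) (fun _ _ _ _ _ => le_rfl) hκ (fun _ _ _ _ _ => by simp) le_rfl
    (shape238_zero R Set.univ _) le_rfl (by norm_num)
    (fun _ => by show (0 : ℝ) / 1 * 1 ≤ 1; norm_num)
    (fun k => by simp [Assembly.bHist])
    (fun _ => by rw [omega_zero]; show (0 * 0 / (1 - 0) + 2 * 0 / (1 / 2 : ℝ) ^ 0) * 1 + 0 * (1 * (0 / (1 - 1 / 2))) ≤ 1; norm_num)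
    le_rfl le_rfl one_pos le_rfl le_rfl le_rfl one_pos (by norm_num) (by norm_num) le_rfl (by rw [omega_zero]; norm_num)
    (by rw [omega_zero]; norm_num) (by norm_num) (by norm_num) (by norm_num) le_rfl
    (fun k hk => absurd hk (Nat.not_lt_zero k))
    (by rw [omega_zero]; norm_num)
  simp only [zero_mul, mul_zero, zero_div, add_zero] at h
  exact h

end Summit.QuantumFields.BalabanUV.T4Continuum.B13StepOfRecordSecantStructuralWitness

end
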